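import Literature.NumberTheory.EllipticCurves.Kato2004.MainConjectureSkeletonProofs
import Literature.NumberTheory.EllipticCurves.IwasawaAlgebraProofs
import Literature.NumberTheory.EllipticCurves.GreenbergVatsal2000.CongruentCurves
import Literature.NumberTheory.EllipticCurves.Rank1Residual.X9MuInvariant
import Summits.BirchSwinnertonDyer.BirchSwinnertonDyer.Theorems.Rank1ResidualX9MuTransfer
import HarnessLib

/-!
# K6 crux `MuTransfer` (stmt-BirchSwinnertonDyer-19629), stub `stub_x9`: the `μ`-BOOKKEEPING of
# KOLY-MEMO Cor. 5.7.2 / MU-TRANSFER-PROOF §6 at the height-one prime `(p)`, as kernel module theory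

Cell `bsd-smallim`, seat `bsd-smallim-k6-c2` (D-0074 group (F)). HONEST FRAMING: theorems only (no
definition, no named fact, D-0026); nothing is asserted about any curve and nothing is booked. This
is the first of the KERNEL files for the registered stub `stub_x9` of the BC3 skeleton
`Cruxes/MuTransfer/Lines/birth.lean` (= Kato μ-transfer ON CLASS X9: one unit coefficient of
`L_p(f, α)` ⟹ `μ(X(E/ℚ_∞)) = 0` at a non-surjective irreducible good ordinary `p ≥ 5`), written —
as the director's purpose of record prescribes — OVER A TYPED Λ-ADIC INTERFACE WITH KATO'S THEOREMS
AS EXPLICIT BINDERS: here the interface is Kato's own §17.13 skeleton (abstract `Λ`-modules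
`H = 𝐇¹(T)`, `P = 𝐇¹_loc/𝐇¹_loc(T')`, `H2 = 𝐇²(T)`, `H2loc`, the zeta submodule `Z ≤ H`, the
Coleman map `col : P ↪ Λ`), exactly the hypotheses of the tree's `Kato2004.lengthAt_add_eq_of_skeleton`
(`Literature/…/Kato2004/MainConjectureSkeletonProofs.lean`), read at the ONE height-one prime
`𝔭 = (p)` where the `μ`-invariant lives (`muInvariant = ℓ_{(p)}`, `muInvariant_eq_toNat_lengthAt`).

## What is proved

* `lengthAt_quotient_span_eq_zero_of_hasUnitContent` — §6 (i)/(iii) analytic side: if `G ∈ Λ` has a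
  unit coefficient (`μ(G) = 0`, e.g. `ι G = L_p(f, α)` with the stub's certificate) then
  `ℓ_{(p)}(Λ/(G)) = 0`.
* `lengthAt_eq_zero_of_skeleton_at_p` — **MU-TRANSFER-PROOF §6 (iii) in the kernel**: Kato's identity
  `ℓ(X)_𝔭 + ℓ(H/Z)_𝔭 = ℓ(Λ/(G))_𝔭 + ℓ(H2)_𝔭` at `𝔭 = (p)` (tree, from (17.13.1)–(17.13.4), 17.11,
  16.6) with `μ(G) = 0` and THEOREM A's conclusion `ℓ_{(p)}(𝐇²) = 0` gives `ℓ_{(p)}(X) = 0` AND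
  `ℓ_{(p)}(H/Z) = 0` ("`μ(X) = μ(Λ/(L_p)) − μ(𝐇¹/Z) + μ(𝐇²) = 0 − 0 + 0`").
* `mu_eq_zero_of_skeleton_at_p` — the same for the Iwasawa module of a Pontryagin-dual datum `D`:
  `D.mu = 0`.
* `lengthAt_eq_zero_of_X_pow_smul_le_p_smul` — **THEOREM A's last step (MU-TRANSFER-PROOF §5, first
  paragraph) in the kernel**: a finitely generated `Λ`-module `M` with `T^k M ⊆ pM` for some `k` (e.g.
  `M/pM` finite) has `ℓ_{(p)}(M) = 0`, i.e. `μ(M) = 0` — by Cayley–Hamilton (`T^k` acting on `M` with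
  image in `pM` satisfies a monic polynomial with coefficients in `(p)`, whose value at `T^k` is an
  element of `Λ ∖ (p)` killing `M`). And `exists_X_pow_smul_le_of_finite_quotient`: `M/pM` finite ⟹
  such a `k` exists (descending chain `T^i(M/pM)` + Nakayama in the local ring `Λ`).
* `mu_eq_zero_of_kato_skeleton_of_finite_H2_mod_p` — the assembled per-datum statement in the
  currency of `stub_x9`: for a newform `f` of `W` with ONE `p`-adic unit coefficient of `L_p(f, α)` and
  a cyclotomic dual datum `D`, GIVEN Kato's §17.13 skeleton at `(p)` with `ι G = L_p(f, α)` AND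
  `𝐇²/p𝐇²` finite (Theorem A), `D.mu = 0`.

What is NOT here: the skeleton itself (Iwasawa cohomology, the Coleman map, Kato's zeta elements are
not in the tree: they stay explicit hypotheses, to be supplied by the typed interface of seat
`bsd-smallim-k6-ty`), and Theorem A proper (`𝐳_1 ∉ p𝐇¹ ⟹ 𝐇²/p𝐇²` finite: sibling files).

References: K. Kato, Astérisque 295 (2004) §17.13 (pp. 279–280), Thm. 12.4, Prop. 17.11, Thm. 16.6
[Kato2004Asterisque]; HOME/koly/MU-TRANSFER-PROOF.md §§5–6 (cell theorem, referee PASS v4–v8);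
L. Washington, *Introduction to Cyclotomic Fields* §13.2 [Washington1997].
-/

-- the summit and its single problem are both named `BirchSwinnertonDyer` (registry layout D-0017)
set_option linter.dupNamespace false

set_option autoImplicit false

noncomputable section

open scoped Classical MatrixGroups ModularForm

open CongruenceSubgroup WeierstrassCurve Field Polynomial
open Literature.NumberTheory.EllipticCurves Literature.NumberTheory.EllipticCurves.ModularForms
open Literature.NumberTheory.EllipticCurves.IwasawaAlgebra
open Literature.NumberTheory.EllipticCurves.Module (lengthAt)

namespace Summit.BirchSwinnertonDyer.BirchSwinnertonDyer.Rank1Residual.KatoMuSkeleton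

variable {p : ℕ} [Fact p.Prime]

/-! ### §1 The analytic side at `(p)`: unit content kills `ℓ_{(p)}(Λ/(G))` -/

/-- `PowerSeries.X ^ n ∉ (p)`: its `n`-th coefficient is `1`. [folklore] -/
theorem X_pow_not_mem_augIdealP (n : ℕ) :
    (PowerSeries.X : IwasawaAlgebra p) ^ n ∉ augIdealP p := by
  intro h
  rw [augIdealP, Ideal.mem_span_singleton,
    Literature.NumberTheory.EllipticCurves.PowerSeries.C_dvd_iff_forall_dvd_coeff] at h
  have h1 := h n
  rw [PowerSeries.coeff_X_pow_self] at h1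
  exact PadicInt.irreducible_p.not_isUnit (isUnit_of_dvd_one h1)

/-- An element of unit content (`μ(G) = 0`: some coefficient is a `p`-adic unit) does not lie in the
height-one prime `(p)`. [folklore] -/
theorem not_mem_augIdealP_of_hasUnitContent {G : IwasawaAlgebra p}
    (hG : GreenbergVatsal2000.HasUnitContent G) : G ∉ augIdealP p := by
  rw [GreenbergVatsal2000.hasUnitContent_iff_not_C_dvd] at hG
  rwa [augIdealP, Ideal.mem_span_singleton]

/-- **`μ(Λ/(G)) = 0` when `G` has unit content**: `Λ/(G)` is killed by `G ∉ (p)`, so its localisation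
at `(p)` vanishes (MU-TRANSFER-PROOF §6 (iii): "`μ(Λ/(L_p)) = 0`"). [folklore] -/
theorem lengthAt_quotient_span_eq_zero_of_hasUnitContent {G : IwasawaAlgebra p}
    (hG : GreenbergVatsal2000.HasUnitContent G) (𝔭 : PrimeSpectrum (IwasawaAlgebra p))
    (h𝔭 : 𝔭.asIdeal = augIdealP p) :
    lengthAt (IwasawaAlgebra p) (IwasawaAlgebra p ⧸ Ideal.span {G}) 𝔭 = 0 := by
  refine Literature.NumberTheory.EllipticCurves.Module.lengthAt_eq_zero_of_isTorsionBy
    (s := G) ?_ 𝔭 (h𝔭 ▸ not_mem_augIdealP_of_hasUnitContent hG)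
  intro x
  induction x using Submodule.Quotient.induction_on with
  | H y =>
    rw [← Submodule.Quotient.mk_smul, Submodule.Quotient.mk_eq_zero, smul_eq_mul]
    exact Ideal.mul_mem_right y _ (Ideal.mem_span_singleton_self G)

/-! ### §2 MU-TRANSFER-PROOF §6 (iii): `μ(X) = μ(Λ/(L_p)) − μ(𝐇¹/Z) + μ(𝐇²) = 0` -/

section CorB

variable {H P X H2 H2loc : Type*} [AddCommGroup H] [Module (IwasawaAlgebra p) H]
  [AddCommGroup P] [Module (IwasawaAlgebra p) P] [AddCommGroup X] [Module (IwasawaAlgebra p) X]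
  [AddCommGroup H2] [Module (IwasawaAlgebra p) H2]
  [AddCommGroup H2loc] [Module (IwasawaAlgebra p) H2loc]

/-- **MU-TRANSFER-PROOF §6 (iii) = KOLY-MEMO Cor. 5.7.2, the bookkeeping, in the kernel.** In Kato's
§17.13 skeleton (`H →loc P →toX X →δ H2 →ε H2loc` exact at `P`, `X`, `H2`, `loc` and the Coleman map
`col : P → Λ` injective, `Z ≤ H` the zeta elements), read at the height-one prime `𝔭 = (p)` with the
three printed inputs there (17.11: `ℓ(Λ/col P)_𝔭 = 0`; (17.13.4): `ℓ(H2loc)_𝔭 = 0`; 16.6 + 17.11: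
the image of `Z` is `Λ · G`), IF `G` has unit content (`μ(L_p) = 0`, the certificate) AND
`ℓ_{(p)}(H2) = 0` (THEOREM A: `μ(𝐇²) = 0`), THEN `ℓ_{(p)}(X) = 0` and `ℓ_{(p)}(H/Z) = 0`: Kato's
identity `ℓ(X) + ℓ(H/Z) = ℓ(Λ/(G)) + ℓ(H2)` (tree `Kato2004.lengthAt_add_eq_of_skeleton`) has
right-hand side `0`. [cite: Kato2004Asterisque, §17.13 (p. 280), Prop. 17.11 (p. 277), Thm. 16.6 (p. 271)] -/
theorem lengthAt_eq_zero_of_skeleton_at_p (loc : H →ₗ[IwasawaAlgebra p] P)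
    (hinj : Function.Injective loc) (toX : P →ₗ[IwasawaAlgebra p] X) (δ : X →ₗ[IwasawaAlgebra p] H2)
    (ε : H2 →ₗ[IwasawaAlgebra p] H2loc)
    (hPX : Function.Exact loc toX) (hXH : Function.Exact toX δ) (hHE : Function.Exact δ ε)
    (col : P →ₗ[IwasawaAlgebra p] IwasawaAlgebra p) (hcol : Function.Injective col)
    (Z : Submodule (IwasawaAlgebra p) H) {G : IwasawaAlgebra p}
    (𝔭 : PrimeSpectrum (IwasawaAlgebra p)) (h𝔭 : 𝔭.asIdeal = augIdealP p)
    (hcoker : lengthAt (IwasawaAlgebra p) (IwasawaAlgebra p ⧸ LinearMap.range col) 𝔭 = 0)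
    (hloc2 : lengthAt (IwasawaAlgebra p) H2loc 𝔭 = 0)
    (hIG : lengthAt (IwasawaAlgebra p) (IwasawaAlgebra p ⧸ (Z.map loc).map col) 𝔭 =
      lengthAt (IwasawaAlgebra p) (IwasawaAlgebra p ⧸ Ideal.span {G}) 𝔭)
    (hG : GreenbergVatsal2000.HasUnitContent G)
    (hA : lengthAt (IwasawaAlgebra p) H2 𝔭 = 0) :
    lengthAt (IwasawaAlgebra p) X 𝔭 = 0 ∧ lengthAt (IwasawaAlgebra p) (H ⧸ Z) 𝔭 = 0 := by
  have h := Kato2004.lengthAt_add_eq_of_skeleton loc hinj toX δ ε hPX hXH hHE col hcol Z 𝔭 hcoker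
    hloc2 hIG
  rw [lengthAt_quotient_span_eq_zero_of_hasUnitContent hG 𝔭 h𝔭, hA, add_zero] at h
  exact add_eq_zero.mp h

end CorB

/-- **The same for the Iwasawa module `X(E/K_∞)` of a Pontryagin-dual datum: `μ(X) = 0`**
(`D.mu = muInvariant p D.X = ℓ_{(p)}(D.X)`). [cite: Kato2004Asterisque, §17.13 (p. 280)] -/
theorem mu_eq_zero_of_skeleton_at_p {K : Type} [Field K] [NumberField K] {W : WeierstrassCurve K}
    {κ : ZpExtension K p} {γ : absoluteGaloisGroup K} (D : W.SelmerDualData κ γ)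
    {H P H2 H2loc : Type*} [AddCommGroup H] [Module (IwasawaAlgebra p) H]
    [AddCommGroup P] [Module (IwasawaAlgebra p) P] [AddCommGroup H2] [Module (IwasawaAlgebra p) H2]
    [AddCommGroup H2loc] [Module (IwasawaAlgebra p) H2loc]
    (loc : H →ₗ[IwasawaAlgebra p] P) (hinj : Function.Injective loc)
    (toX : P →ₗ[IwasawaAlgebra p] D.X) (δ : D.X →ₗ[IwasawaAlgebra p] H2)
    (ε : H2 →ₗ[IwasawaAlgebra p] H2loc)
    (hPX : Function.Exact loc toX) (hXH : Function.Exact toX δ) (hHE : Function.Exact δ ε)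
    (col : P →ₗ[IwasawaAlgebra p] IwasawaAlgebra p) (hcol : Function.Injective col)
    (Z : Submodule (IwasawaAlgebra p) H) {G : IwasawaAlgebra p}
    (𝔭 : PrimeSpectrum (IwasawaAlgebra p)) (h𝔭 : 𝔭.asIdeal = augIdealP p)
    (hcoker : lengthAt (IwasawaAlgebra p) (IwasawaAlgebra p ⧸ LinearMap.range col) 𝔭 = 0)
    (hloc2 : lengthAt (IwasawaAlgebra p) H2loc 𝔭 = 0)
    (hIG : lengthAt (IwasawaAlgebra p) (IwasawaAlgebra p ⧸ (Z.map loc).map col) 𝔭 =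
      lengthAt (IwasawaAlgebra p) (IwasawaAlgebra p ⧸ Ideal.span {G}) 𝔭)
    (hG : GreenbergVatsal2000.HasUnitContent G)
    (hA : lengthAt (IwasawaAlgebra p) H2 𝔭 = 0) : D.mu = 0 := by
  have h := (lengthAt_eq_zero_of_skeleton_at_p loc hinj toX δ ε hPX hXH hHE col hcol Z 𝔭 h𝔭 hcoker
    hloc2 hIG hG hA).1
  change muInvariant p D.X = 0
  rw [muInvariant_eq_toNat_lengthAt p D.X 𝔭 h𝔭, h, ENat.toNat_zero]

/-! ### §3 THEOREM A's last step: `T^k · 𝐇² ⊆ p𝐇²` (e.g. `𝐇²/p𝐇²` finite) ⟹ `μ(𝐇²) = 0` -/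

section ThmALast

variable {M : Type*} [AddCommGroup M] [Module (IwasawaAlgebra p) M]

/-- **`T^k M ⊆ pM` for a finitely generated `Λ`-module `M` forces `ℓ_{(p)}(M) = 0` (`μ(M) = 0`).**
Cayley–Hamilton (Mathlib `LinearMap.exists_monic_and_coeff_mem_pow_and_aeval_eq_zero_of_range_le_smul`):
the endomorphism `T^k` of `M` has image in `(p)M`, so it satisfies a monic `q ∈ Λ[Y]` whose
non-leading coefficients lie in `(p)`; then `c := q(T^k) ∈ Λ` kills `M` and `c ≡ T^{k·deg q} ≢ 0
(mod p)`, so `M_{(p)} = 0`. This is the structure-theory sentence of MU-TRANSFER-PROOF §5 ("`𝐇²/p𝐇²`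
finite, hence no `Λ/p^{μ_i}` occurs: `μ(𝐇²) = 0`") without invoking the structure theorem.
[cite: Washington1997, §13.2] -/
theorem lengthAt_eq_zero_of_X_pow_smul_le_p_smul [Module.Finite (IwasawaAlgebra p) M] (k : ℕ)
    (hk : ∀ m : M, ∃ m' : M,
      (PowerSeries.X : IwasawaAlgebra p) ^ k • m = (PowerSeries.C (p : ℤ_[p]) : IwasawaAlgebra p) • m')
    (𝔭 : PrimeSpectrum (IwasawaAlgebra p)) (h𝔭 : 𝔭.asIdeal = augIdealP p) :
    lengthAt (IwasawaAlgebra p) M 𝔭 = 0 := by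
  set Λ' := IwasawaAlgebra p
  set t : Λ' := (PowerSeries.X : Λ') ^ k with ht
  let φ : Module.End Λ' M := Algebra.lsmul Λ' Λ' M t
  have hφ : LinearMap.range φ ≤ augIdealP p • (⊤ : Submodule Λ' M) := by
    rintro _ ⟨m, rfl⟩
    obtain ⟨m', hm'⟩ := hk m
    change t • m ∈ _
    rw [hm']
    exact Submodule.smul_mem_smul (Ideal.mem_span_singleton_self _) Submodule.mem_top
  obtain ⟨q, hmonic, -, hcoeff, hq⟩ :=
    LinearMap.exists_monic_and_natDegree_eq_and_coeff_mem_pow_and_aeval_eq_zero Λ' φ (augIdealP p) hφ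
  -- `c := q(t)` kills `M`
  set c : Λ' := Polynomial.aeval t q with hc
  have hcM : Module.IsTorsionBy Λ' M c := by
    intro m
    have h1 : Polynomial.aeval φ q = Algebra.lsmul Λ' Λ' M c := by
      rw [hc, show φ = Algebra.lsmul Λ' Λ' M t from rfl, Polynomial.aeval_algHom_apply]
    have h2 := LinearMap.congr_fun hq m
    rw [h1] at h2
    simpa using h2
  -- `c ∉ (p)`: `c - t^n ∈ (p)` and `t^n = X^{kn} ∉ (p)`
  have hct : c - t ^ q.natDegree ∈ augIdealP p := by
    rw [hc, Polynomial.aeval_eq_sum_range, Finset.sum_range_succ, hmonic.coeff_natDegree, one_smul,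
      add_sub_cancel_right]
    refine Submodule.sum_mem _ fun i hi => ?_
    rw [Finset.mem_range] at hi
    have hci : q.coeff i ∈ augIdealP p := by
      have := hcoeff i
      exact Ideal.pow_le_self (by omega) this
    rw [smul_eq_mul]
    exact Ideal.mul_mem_right _ _ hci
  have hcn : c ∉ augIdealP p := by
    intro hcin
    have : t ^ q.natDegree ∈ augIdealP p := by
      have := Submodule.sub_mem _ hcin hct
      rwa [sub_sub_cancel] at this
    rw [ht, ← pow_mul] at this
    exact X_pow_not_mem_augIdealP _ this
  exact Literature.NumberTheory.EllipticCurves.Module.lengthAt_eq_zero_of_isTorsionBy hcM 𝔭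
    (h𝔭 ▸ hcn)

/-- **A FINITE quotient `M/N` is killed by a power of `T`**: the chain `T^i · (M/N)` stabilises,
and `T·N' = N'` for a finitely generated `N'` forces `N' = 0` (Nakayama; `T` lies in the maximal
ideal `(p, T)` of the local ring `Λ`). With `N = pM` this is the input of
`lengthAt_eq_zero_of_X_pow_smul_le_p_smul`. [folklore] -/
theorem exists_X_pow_smul_mem_of_finite_quotient (N : Submodule (IwasawaAlgebra p) M)
    [Finite (M ⧸ N)] :
    ∃ k : ℕ, ∀ m : M, (PowerSeries.X : IwasawaAlgebra p) ^ k • m ∈ N := by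
  set Λ' := IwasawaAlgebra p
  let I : Ideal Λ' := Ideal.span {(PowerSeries.X : Λ')}
  -- the decreasing chain `I^i • ⊤` in the finite module `M ⧸ N`
  let f : ℕ → Submodule Λ' (M ⧸ N) := fun i => I ^ i • ⊤
  have hanti : ∀ i, f (i + 1) ≤ f i := fun i => by
    change I ^ (i + 1) • (⊤ : Submodule Λ' (M ⧸ N)) ≤ I ^ i • ⊤
    rw [pow_succ', Submodule.mul_smul]
    exact Submodule.smul_le_right
  haveI : Finite (Submodule Λ' (M ⧸ N)) :=
    Finite.of_injective (fun S : Submodule Λ' (M ⧸ N) => (S : Set (M ⧸ N)))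
      fun S T h => SetLike.coe_injective h
  obtain ⟨k, hk⟩ : ∃ k, f (k + 1) = f k := by
    by_contra hne
    push Not at hne
    have hstrict : StrictAnti f := strictAnti_nat_of_succ_lt fun i => lt_of_le_of_ne (hanti i) (hne i)
    exact not_injective_infinite_finite f hstrict.injective
  -- Nakayama: `I • f k = f k`, `I` inside the Jacobson radical, `f k` finitely generated ⟹ `f k = ⊥`
  have hIjac : I ≤ Ideal.jacobson ⊥ := by
    rw [IsLocalRing.jacobson_eq_maximalIdeal ⊥ bot_ne_top, Ideal.span_le, Set.singleton_subset_iff]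
    refine (IsLocalRing.mem_maximalIdeal _).mpr ?_
    rw [mem_nonunits_iff, PowerSeries.isUnit_iff_constantCoeff, PowerSeries.constantCoeff_X]
    exact not_isUnit_zero
  have hfg : (f k).FG := Module.Finite.iff_fg.mp inferInstance
  have hle : f k ≤ I • f k := by
    have hk' : f k = I • f k := by
      calc f k = f (k + 1) := hk.symm
        _ = I • f k := by
          change I ^ (k + 1) • (⊤ : Submodule Λ' (M ⧸ N)) = I • (I ^ k • ⊤)
          rw [pow_succ', Submodule.mul_smul]
    exact hk'.le
  have hbot : f k = ⊥ := Submodule.eq_bot_of_le_smul_of_le_jacobson_bot I (f k) hfg hle hIjac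
  refine ⟨k, fun m => ?_⟩
  have hm : (I ^ k • (⊤ : Submodule Λ' (M ⧸ N))) = ⊥ := hbot
  have hmem : (PowerSeries.X : Λ') ^ k • N.mkQ m ∈ I ^ k • (⊤ : Submodule Λ' (M ⧸ N)) :=
    Submodule.smul_mem_smul (Ideal.pow_mem_pow (Ideal.mem_span_singleton_self _) k) Submodule.mem_top
  rw [hm, Submodule.mem_bot, ← map_smul, Submodule.mkQ_apply, Submodule.Quotient.mk_eq_zero] at hmem
  exact hmem

/-- **`𝐇²/p𝐇²` finite ⟹ `μ(𝐇²) = 0`** (the two previous lemmas; MU-TRANSFER-PROOF §5, first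
paragraph, for a finitely generated `Λ`-module). [cite: Washington1997, §13.2] -/
theorem lengthAt_eq_zero_of_finite_quotient_p [Module.Finite (IwasawaAlgebra p) M]
    [Finite (M ⧸ (augIdealP p • (⊤ : Submodule (IwasawaAlgebra p) M)))]
    (𝔭 : PrimeSpectrum (IwasawaAlgebra p)) (h𝔭 : 𝔭.asIdeal = augIdealP p) :
    lengthAt (IwasawaAlgebra p) M 𝔭 = 0 := by
  obtain ⟨k, hk⟩ := exists_X_pow_smul_mem_of_finite_quotient
    (augIdealP p • (⊤ : Submodule (IwasawaAlgebra p) M))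
  refine lengthAt_eq_zero_of_X_pow_smul_le_p_smul k (fun m => ?_) 𝔭 h𝔭
  have h := hk m
  rw [augIdealP, Submodule.ideal_span_singleton_smul, Submodule.mem_smul_pointwise_iff_exists] at h
  obtain ⟨m', -, hm'⟩ := h
  exact ⟨m', hm'.symm⟩

end ThmALast

/-! ### §4 Assembled, in the currency of `stub_x9`: Kato's skeleton at `(p)` + Theorem A ⟹ `μ(X) = 0` -/

/-- **KOLY-MEMO Cor. 5.7.2 (iii) for ONE datum, modulo its inputs, in the kernel.** Let `W/K` be a
Weierstrass curve over a number field, `D` a Pontryagin-dual datum of `Sel_{p^∞}(E/K_∞)` for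
`(κ, γ)`, `f` a weight-2 cusp form and `α ∈ ℤ_p` (intended: `K = ℚ`, `f` the newform of `E`,
`α = unitRoot W p`). GIVEN (i) Kato's §17.13 skeleton towards `D.X` — `H →loc P →toX D.X →δ H2 →ε
H2loc` exact, `loc` and the Coleman map `col : P ↪ Λ` injective, the zeta submodule `Z ≤ H` whose
image generates `(G)` at `(p)` with `ι G = L_p(f, α)`, and the two finiteness inputs at `(p)`
(17.11, (17.13.4)) [Kato 2004 Thms. 12.4, 12.6, 16.6, Prop. 17.11, §17.13 — to be supplied by the
typed Λ-adic interface]; (ii) THEOREM A's conclusion: `𝐇²/p𝐇²` is finite (`H2` finitely generated);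
(iii) the stub's certificate: one coefficient of `L_p(f, α)` is a `p`-adic unit — THEN
`μ(X(E/K_∞)) = 0` (`D.mu = 0`). This is exactly MU-TRANSFER-PROOF §6 (iii) ∘ §5 (first paragraph).
[cite: Kato2004Asterisque, §17.13 (p. 280), Prop. 17.11 (p. 277), Thm. 16.6 (p. 271)] -/
theorem mu_eq_zero_of_kato_skeleton_of_finite_H2_mod_p {K : Type} [Field K] [NumberField K]
    {W : WeierstrassCurve K} {κ : ZpExtension K p} {γ : absoluteGaloisGroup K}
    (D : W.SelmerDualData κ γ) {N : ℕ} (f : CuspForm (Gamma0 N) 2) (α : ℚ_[p])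
    (hcert : ∃ n : ℕ, ‖PowerSeries.coeff n (padicLFunction f α)‖ = 1)
    {H P H2 H2loc : Type*} [AddCommGroup H] [Module (IwasawaAlgebra p) H]
    [AddCommGroup P] [Module (IwasawaAlgebra p) P] [AddCommGroup H2] [Module (IwasawaAlgebra p) H2]
    [AddCommGroup H2loc] [Module (IwasawaAlgebra p) H2loc]
    (loc : H →ₗ[IwasawaAlgebra p] P) (hinj : Function.Injective loc)
    (toX : P →ₗ[IwasawaAlgebra p] D.X) (δ : D.X →ₗ[IwasawaAlgebra p] H2)
    (ε : H2 →ₗ[IwasawaAlgebra p] H2loc)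
    (hPX : Function.Exact loc toX) (hXH : Function.Exact toX δ) (hHE : Function.Exact δ ε)
    (col : P →ₗ[IwasawaAlgebra p] IwasawaAlgebra p) (hcol : Function.Injective col)
    (Z : Submodule (IwasawaAlgebra p) H) {G : IwasawaAlgebra p}
    (hιG : iwasawaToPowerSeries p G = padicLFunction f α)
    (hcoker : ∀ 𝔭 : PrimeSpectrum (IwasawaAlgebra p), 𝔭.asIdeal = augIdealP p →
      lengthAt (IwasawaAlgebra p) (IwasawaAlgebra p ⧸ LinearMap.range col) 𝔭 = 0)
    (hloc2 : ∀ 𝔭 : PrimeSpectrum (IwasawaAlgebra p), 𝔭.asIdeal = augIdealP p →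
      lengthAt (IwasawaAlgebra p) H2loc 𝔭 = 0)
    (hIG : ∀ 𝔭 : PrimeSpectrum (IwasawaAlgebra p), 𝔭.asIdeal = augIdealP p →
      lengthAt (IwasawaAlgebra p) (IwasawaAlgebra p ⧸ (Z.map loc).map col) 𝔭 =
        lengthAt (IwasawaAlgebra p) (IwasawaAlgebra p ⧸ Ideal.span {G}) 𝔭)
    [Module.Finite (IwasawaAlgebra p) H2]
    [Finite (H2 ⧸ (augIdealP p • (⊤ : Submodule (IwasawaAlgebra p) H2)))] :
    D.mu = 0 := by
  let 𝔭 : PrimeSpectrum (IwasawaAlgebra p) := ⟨augIdealP p, isPrime_augIdealP_holds p⟩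
  have hG : GreenbergVatsal2000.HasUnitContent G :=
    Literature.NumberTheory.EllipticCurves.Rank1Residual.hasUnitContent_of_map_eq G _ hιG hcert
  have hA : lengthAt (IwasawaAlgebra p) H2 𝔭 = 0 := lengthAt_eq_zero_of_finite_quotient_p 𝔭 rfl
  exact mu_eq_zero_of_skeleton_at_p D loc hinj toX δ ε hPX hXH hHE col hcol Z 𝔭 rfl (hcoker 𝔭 rfl)
    (hloc2 𝔭 rfl) (hIG 𝔭 rfl) hG hA

end Summit.BirchSwinnertonDyer.BirchSwinnertonDyer.Rank1Residual.KatoMuSkeleton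

end
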